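import Summits.PneNP.PneNP.Theses.LatticeMagic
import Summits.PneNP.PneNP.Theorems.ProofCplxAssembly
import Literature.Barriers.PneNP.LatticeGapCoNP
import Literature.Algebra.EuclideanLattices.GapCVPConstNPHardProofs
import Literature.Algebra.EuclideanLattices.GapCVPVerifier
import Literature.Computability.Complexity.ClayProblemProofs
import Literature.Computability.Complexity.NondeterministicProofs

/-!
# Route LatticeMagic — the crux `Target` (stmt-PneNP-10709) is, inside the tree, the open problem `NP ≠ coNP`

`Target` = "for some constant `c ≥ 1`, GapCVP_c ∉ PromiseCoNP".  Both directions of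
`Target ↔ NP ≠ coNP` follow from LANDED, sorry-free tree theorems:

* (→) if `NP = coNP` then `PromiseCoNP = PromiseNP`, and GapCVP_c ∈ PromiseNP for every `c ≥ 1`
  (`Literature.Algebra.EuclideanLattices.gapCVP_mem_promiseNP_holds`, the TM2 verifier of
  `‖zB − t‖² ≤ d²` [Aharonov–Regev 2005, §1 p. 2 "containment in NP is trivial"]);
* (←) GapCVP_2 is NP-hard under Karp reductions of promise problems
  (`Literature.Algebra.EuclideanLattices.isNPHard_gapCVPPromise_const`, Arora–Babai–Stern–Sweedyk 1997
  Thm. 5 (i), proved in the tree through the gap-PCP / label-cover chain), and an NP-hard promise problem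
  inside `PromiseCoNP` forces `NP = coNP`
  (`Literature.Barriers.PneNP.np_eq_coNP_of_isNPHard_of_mem_PromiseCoNP`, Aharonov–Regev 2005 App. B).

Consequences recorded for the crux chain (line `Sketch`, lead prover, 2026-08-16):
`latticeMagicTarget_line_closure_proves_NP_ne_coNP` — whatever conjunction of stubs `D` a skeleton
composes into `Target` (`D → Target` kernel-checked), a proof of `D` is a proof of `NP ≠ coNP` (and of the
summit `PneNP`); so every line for this crux closes iff the tree proves `NP ≠ coNP` through it.
-/

set_option linter.dupNamespace false

namespace Summit.PneNP.PneNP.Theorems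

open Literature.Computability.Complexity
open Summit.PneNP.PneNP.Theses.LatticeMagic (Target)

/-- The route's spelled-out GapCVP_c promise problem is `gapCVPPromise (fun _ => c)` (definitional).
[cite: MicciancioGoldwasser2002, Ch. 1 §1.2] -/
theorem latticeMagic_ofEncoding_eq_gapCVPPromise (c : ℝ) :
    PromiseProblem.ofEncoding Literature.Algebra.EuclideanLattices.gapCVPInstanceEncoding
        (Literature.Algebra.EuclideanLattices.GapCVP.yes (fun _ => c))
        (Literature.Algebra.EuclideanLattices.GapCVP.no (fun _ => c)) =
      Literature.Algebra.EuclideanLattices.gapCVPPromise (fun _ => c) :=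
  rfl

/-- **`NP ≠ coNP → Target`** (with the constant `c = 2`): GapCVP_2 is NP-hard (Arora et al. 1997,
tree theorem `isNPHard_gapCVPPromise_const`), so GapCVP_2 ∈ PromiseCoNP would give `NP = coNP`
(Aharonov–Regev 2005 App. B, tree theorem `np_eq_coNP_of_isNPHard_of_mem_PromiseCoNP`).
[cite: AroraEtAl1997, Thm. 5 (i)] [cite: AharonovRegev2005, App. B] -/
theorem latticeMagicTarget_of_NP_ne_coNP (hne : Nondeterministic.NP ≠ coNP) : Target := by
  refine ⟨2, by norm_num, fun hco => hne ?_⟩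
  have hhard : (Literature.Algebra.EuclideanLattices.gapCVPPromise fun _ => ((2 : ℚ) : ℝ)).IsNPHard :=
    Literature.Algebra.EuclideanLattices.isNPHard_gapCVPPromise_const (by norm_num)
  have h2 : ((2 : ℚ) : ℝ) = 2 := by norm_num
  rw [h2] at hhard
  exact Literature.Barriers.PneNP.np_eq_coNP_of_isNPHard_of_mem_PromiseCoNP hco hhard

/-- **`Target → NP ≠ coNP`**: if `NP = coNP` then `PromiseCoNP = PromiseNP ∋ GapCVP_c` for every
`c ≥ 1` (Aharonov–Regev 2005 §1: containment in NP is trivial; tree theorem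
`gapCVP_mem_promiseNP_holds`). [cite: AharonovRegev2005, §1 (p. 2)] -/
theorem NP_ne_coNP_of_latticeMagicTarget (hT : Target) : Nondeterministic.NP ≠ coNP := by
  obtain ⟨c, hc, hnot⟩ := hT
  intro heq
  apply hnot
  have hNP : Literature.Algebra.EuclideanLattices.gapCVPPromise (fun _ => c) ∈ PromiseNP :=
    Literature.Algebra.EuclideanLattices.gapCVP_mem_promiseNP_holds (fun _ => c) (fun _ => hc)
  show Literature.Algebra.EuclideanLattices.gapCVPPromise (fun _ => c) ∈ promiseLift coNP
  rw [← heq]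
  exact hNP

/-- **The crux is `NP ≠ coNP`.** `Target ↔ NP ≠ coNP` over the tree's classes
(`Nondeterministic.NP`, `coNP = co NP`). [cite: AroraEtAl1997, Thm. 5 (i)] [cite: AharonovRegev2005, §1 and App. B] -/
theorem latticeMagicTarget_iff_NP_ne_coNP : Target ↔ Nondeterministic.NP ≠ coNP :=
  ⟨NP_ne_coNP_of_latticeMagicTarget, latticeMagicTarget_of_NP_ne_coNP⟩

/-- `Target` already yields the summit statement `PneNP` (through `NP ≠ coNP` and the landed
proof-complexity assembly `Literature.CplxMeta.proofcplx_assembly` fed with the proved bridges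
`P_subset_NP_holds`, `P_bool_eq_holds`, `NP_bool_eq_holds`, `co_P_holds`). [folklore] -/
theorem pneNP_of_latticeMagicTarget (hT : Target) : _root_.PneNP :=
  Literature.CplxMeta.proofcplx_assembly P_subset_NP_holds P_bool_eq_holds NP_bool_eq_holds co_P_holds
    (NP_ne_coNP_of_latticeMagicTarget hT)

/-- **Meta-fact for every line of this crux.** If a skeleton composes stubs `D` into `Target`
(`D → Target` kernel-checked), then a proof of `D` is a proof of `NP ≠ coNP`. [folklore] -/
theorem latticeMagicTarget_line_closure_proves_NP_ne_coNP {D : Prop} (hline : D → Target) (hD : D) :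
    Nondeterministic.NP ≠ coNP :=
  NP_ne_coNP_of_latticeMagicTarget (hline hD)

/-- … and a proof of the summit statement `PneNP`. [folklore] -/
theorem latticeMagicTarget_line_closure_proves_pneNP {D : Prop} (hline : D → Target) (hD : D) :
    _root_.PneNP :=
  pneNP_of_latticeMagicTarget (hline hD)

end Summit.PneNP.PneNP.Theorems
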